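/-
COR-CM (cell pub-hodgecm2 = stage 2 of the Hodge ladder), seat b26 gen 17 (prover-pub-hodgecm2-b26-g17-0, 2026-08-21);
count-neutral for the binder table (no row).  Sequel of `Assembly/EllipticCurveEndomorphismAlgebra`: isogeny classes of
CM elliptic curves are classified by their CM fields.  Theorems only: no definition, no notation, no named fact, no
instance.
-/
import Summits.HodgeConjecture.CorCM.Assembly.EllipticCurveEndomorphismAlgebra
import HarnessLib

/-!
# CM elliptic curves are isogenous iff they have complex multiplication by the same field

For complex elliptic curves `E`, `E'` with complex multiplications `ψ ≫ ψ = -(d • 𝟙 E)`, `ψ' ≫ ψ' = -(d' • 𝟙 E')`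
(`d, d' ≥ 1`; CM by orders of `ℚ(√-d)`, `ℚ(√-d')`), the tree proves that `d d'` a square — i.e.
`ℚ(√-d) = ℚ(√-d')` — makes them Hodge-isogenous (`EllipticCurve.hodgeIsogenous_of_cm_of_isSquare`), hence isogenous
(Riemann, `EllipticCurve.moonenZarhin_lemma33_isIsogenous`).  This file proves the CONVERSE and packages the
classification:

* `isSquare_of_isIsogenous_of_cm` — **isogenous CM elliptic curves have `d d'` a square**: an isogeny `E → E'`
  gives an injective `ℚ`-algebra homomorphism `End⁰(E) → End⁰(E')` (`IsIsogeny.exists_algHom_injective`, Mumford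
  §19), so `End⁰(E') = ℚ·1 ⊕ ℚ·ψ'` (dimension `2` by `finrank_endAlgebra_eq_two_iff_isOfCMType`) contains
  `y = s + t ψ'` with `y² = -d`; comparing coefficients, `2st = 0` and `s² - d' t² = -d`, whence `s = 0` and
  `d d' = (d' t)²` (`CMQuadraticOrder.isSquare_mul_of_sq_eq_neg`, pure algebra);
* `isIsogenous_iff_isSquare_of_cm` — **`E ~ E'` iff `d d'` is a square** (classical: CM elliptic curves over `ℂ` are isogenous iff their CM
  fields coincide — Silverman AEC VI Thm. 4.1/5.5 with ATAEC II §1 Prop. 1.2, 1.4; Moonen–Zarhin (2.1) Type IV(1,1) with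
  Lemma (3.3));
* `isIsogenous_iff_nonempty_algEquiv_of_cm`, `…_of_isOfCMType` — **`E ~ E'` iff `End⁰(E) ≅ End⁰(E')` as
  `ℚ`-algebras**, for CM curves (for curves of CM type in Milne's sense via
  `isOfCMType_iff_exists_cm_of_dim_eq_one`); `not_isIsogenous_of_cm_of_not_isSquare` is the form consumed by the
  two-CM-curve anchors (`¬ IsSquare (d₁ d₂)` ⟹ `E₁ ≁ E₂`).

HONEST SCOPE: classification of CM elliptic curves up to isogeny through `End⁰` and Riemann's theorem (tree theorem
`deligneMilne1982_Thm_6_20_full_holds`); nothing here bears on HC_CM or on the summit.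

References: [SilvermanAdvancedTopics1994] J. Silverman, *Advanced Topics in the Arithmetic of Elliptic Curves*, II §1
(Prop. 1.2, Prop. 1.4: the curves with CM by `R_K` form one `CL(R_K)`-orbit, linked by the isogenies `E → 𝔞 ∗ E`) ·
[SilvermanAEC2009] J. Silverman, *The Arithmetic of Elliptic Curves*, VI §4 Thm. 4.1, §5 Thm. 5.5 · [MoonenZarhin1999LowDim] Math. Ann. 315 (1999), §2 (2.1), §3 Lemma (3.3) · [MumfordAV1970]
§19 (Remark p. 169, Cor. 2 of Thm. 1) · [LangeBirkenhake1992] §1.2 Prop. 1.2.3, Thm. 4.2.1.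
-/

noncomputable section

open CategoryTheory Module
open Literature.AlgebraicGeometry.Motives Literature.AlgebraicGeometry.HodgeTheory
open Literature.AlgebraicGeometry.ComplexMultiplication Literature.AlgebraicGeometry.Milne1999

/-! ## §1 Algebra: square roots of `-d` in `ℚ·1 ⊕ ℚ·x`, `x² = -d'` -/

namespace Summit.HodgeConjecture.CorCM.CMQuadraticOrder

open Literature.AlgebraicGeometry.HodgeTheory.CMQuadraticOrder

variable {R : Type*} [Ring R] [Algebra ℚ R] (x : R) {d d' : ℕ}

/-- `1, x` are linearly independent in a non-zero `ℚ`-algebra when `x² = -d'`, `d' ≥ 1` (a vanishing non-trivial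
combination `s + t x` would be a unit, `isUnit_pair`). [folklore] -/
theorem eq_zero_of_pair_eq_zero [Nontrivial R] (hx : x * x = -((d' : ℚ) • (1 : R))) (hd' : 0 < d') {s t : ℚ}
    (h : s • (1 : R) + t • x = 0) : s = 0 ∧ t = 0 := by
  by_contra hst
  exact (isUnit_pair x hx hd' hst).ne_zero h

/-- **In `ℚ·1 ⊕ ℚ·x` with `x² = -d'` (`d' ≥ 1`), a square root of `-d` (`d ≥ 1`) forces `d d'` to be a square**: if
every element is `s + t x` and `y² = -d`, then writing `y = s + t x` gives `2 s t = 0` and `s² - d' t² = -d`, so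
`s = 0` and `d d' = (d' t)²`.  (The imaginary quadratic fields `ℚ(√-d)`, `ℚ(√-d')` coincide iff `d d'` is a
square.) [folklore] -/
theorem isSquare_mul_of_sq_eq_neg [Nontrivial R] (hx : x * x = -((d' : ℚ) • (1 : R))) (hd' : 0 < d')
    (hspan : ∀ y : R, ∃ s t : ℚ, s • (1 : R) + t • x = y) (hd : 0 < d) {y : R}
    (hy : y * y = -((d : ℚ) • (1 : R))) : IsSquare (d * d') := by
  obtain ⟨s, t, rfl⟩ := hspan y
  rw [pair_mul_pair x hx] at hy
  have h0 : (s * s - d' * t * t + d) • (1 : R) + (s * t + t * s) • x = 0 := by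
    rw [add_smul, add_assoc, add_comm ((d : ℚ) • (1 : R)), ← add_assoc, hy, neg_add_cancel]
  obtain ⟨h1, h2⟩ := eq_zero_of_pair_eq_zero x hx hd' h0
  have hs : s = 0 := by
    by_contra hs
    have ht : t = 0 := by
      have : 2 * s * t = 0 := by linear_combination h2
      rcases mul_eq_zero.1 this with h | h
      · exact absurd ((mul_eq_zero.1 h).resolve_left two_ne_zero) hs
      · exact h
    rw [ht] at h1
    have : (0 : ℚ) < s * s + d := by
      have hd0 : (0 : ℚ) < d := Nat.cast_pos.2 hd
      nlinarith [mul_self_nonneg s]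
    linarith
  rw [hs] at h1
  have hsq : ((d * d' : ℕ) : ℚ) = (d' * t) * (d' * t) := by
    push_cast
    linear_combination (d' : ℚ) * h1
  exact Rat.isSquare_natCast_iff.1 ⟨d' * t, hsq⟩

/-- **A two-dimensional `ℚ`-algebra containing `x` with `x² = -d'` (`d' ≥ 1`) is `ℚ·1 ⊕ ℚ·x`**: `1, x` are
independent (`eq_zero_of_pair_eq_zero`), hence a basis. (Stated for an abstract algebra `R`; instantiated at
`End⁰` of a CM elliptic curve below.) [folklore] -/
theorem exists_pair_eq_of_finrank_eq_two [Nontrivial R] [Module.Finite ℚ R] (hx : x * x = -((d' : ℚ) • (1 : R)))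
    (hd' : 0 < d') (h2 : Module.finrank ℚ R = 2) (y : R) : ∃ s t : ℚ, s • (1 : R) + t • x = y := by
  have hli : LinearIndependent ℚ ![(1 : R), x] :=
    LinearIndependent.pair_iff.2 fun _ _ hst => eq_zero_of_pair_eq_zero x hx hd' hst
  have hcard : Fintype.card (Fin 2) = Module.finrank ℚ R := by rw [h2, Fintype.card_fin]
  let b := basisOfLinearIndependentOfCardEqFinrank hli hcard
  refine ⟨b.repr y 0, b.repr y 1, ?_⟩
  conv_rhs => rw [← b.sum_repr y]
  simp [b, Fin.sum_univ_two, coe_basisOfLinearIndependentOfCardEqFinrank]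

/-- An injective `ℚ`-algebra homomorphism between finite-dimensional `ℚ`-algebras of the same dimension is
bijective. (Abstract algebras; instantiated at `End⁰` of isogenous elliptic curves below.) [folklore] -/
theorem bijective_of_injective_of_finrank_eq {S : Type*} [Ring S] [Algebra ℚ S] [Module.Finite ℚ R]
    [Module.Finite ℚ S] (Θ : R →ₐ[ℚ] S) (hΘ : Function.Injective Θ)
    (h : Module.finrank ℚ R = Module.finrank ℚ S) : Function.Bijective Θ :=
  ⟨hΘ, (LinearMap.injective_iff_surjective_of_finrank_eq_finrank h (f := Θ.toLinearMap)).1 hΘ⟩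

end Summit.HodgeConjecture.CorCM.CMQuadraticOrder

/-! ## §2 CM elliptic curves: `End⁰(E') = ℚ·1 ⊕ ℚ·ψ'` and the converse of «same field ⟹ isogenous» -/

namespace Summit.HodgeConjecture.CorCM.PeriodCurve

variable {E E' : AbelianVariety ℂ} {d d' : ℕ} {ψ : E ⟶ E} {ψ' : E' ⟶ E'}

/-- `ψ ≫ ψ = -(d • 𝟙 E)` read in `End⁰(E)`: `(1 ⊗ ψ)² = -d · 1`. [cite: MumfordAV1970, §19 Thm. 3 and Cor. 2] -/
theorem endAlgebra_of_mul_self_of_cm (hψ : ψ ≫ ψ = -(d • 𝟙 E)) :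
    AbelianVariety.endAlgebra.of E (End.of ψ) * AbelianVariety.endAlgebra.of E (End.of ψ) =
      -((d : ℚ) • (1 : E.endAlgebra)) := by
  have hψ' : End.of ψ * End.of ψ = -(d • (1 : End E)) := hψ
  rw [← map_mul, hψ', map_neg, map_nsmul, map_one, Nat.cast_smul_eq_nsmul]

/-- `End⁰` of an elliptic curve is a non-zero ring. [folklore] -/
theorem nontrivial_endAlgebra_of_dim_eq_one (hE : E.dim = 1) : Nontrivial E.endAlgebra :=
  Module.nontrivial_of_finrank_pos (R := ℚ) (one_le_finrank_endAlgebra_of_dim_eq_one hE)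

/-- **`End⁰(E') = ℚ·1 ⊕ ℚ·ψ'` for a CM elliptic curve**: every element of `End⁰(E')` is `s + t ψ'` (`1, ψ'` are
independent and `dim_ℚ End⁰(E') = 2`, `finrank_endAlgebra_eq_two_iff_isOfCMType` with `isOfCMType_of_cmCurve`).
[cite: MoonenZarhin1999LowDim, §2 (2.1) (g = 1), Type IV(1,1)] [cite: SilvermanAEC2009, VI §5 Thm. 5.5] -/
theorem exists_pair_eq_of_cm (hE' : E'.dim = 1) (hd' : 0 < d') (hψ' : ψ' ≫ ψ' = -(d' • 𝟙 E'))
    (y : E'.endAlgebra) :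
    ∃ s t : ℚ, s • (1 : E'.endAlgebra) + t • AbelianVariety.endAlgebra.of E' (End.of ψ') = y := by
  haveI := nontrivial_endAlgebra_of_dim_eq_one hE'
  haveI : Module.Finite ℚ E'.endAlgebra := AbelianVariety.finiteDimensional_endAlgebra_holds E'
  exact CMQuadraticOrder.exists_pair_eq_of_finrank_eq_two _ (endAlgebra_of_mul_self_of_cm hψ') hd'
    ((finrank_endAlgebra_eq_two_iff_isOfCMType hE').2 (isOfCMType_of_cmCurve hE' hd' hψ')) y

/-- **Isogenous CM elliptic curves have complex multiplication by the same field**: if `ψ ≫ ψ = -(d • 𝟙 E)`,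
`ψ' ≫ ψ' = -(d' • 𝟙 E')` (`d, d' ≥ 1`) and `E ~ E'`, then `d d'` is a square (`ℚ(√-d) = ℚ(√-d')`): transport `ψ`
along the injective `End⁰(E) → End⁰(E')` of the isogeny (`IsIsogeny.exists_algHom_injective`) and compare
coefficients in `End⁰(E') = ℚ·1 ⊕ ℚ·ψ'`.  Converse of the tree's `EllipticCurve.hodgeIsogenous_of_cm_of_isSquare`.
[cite: SilvermanAdvancedTopics1994, II §1 Prop. 1.2 and Prop. 1.4] [cite: SilvermanAEC2009, VI §4 Thm. 4.1 and §5 Thm. 5.5] [cite: MumfordAV1970, §19 Remark p. 169]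
[cite: MoonenZarhin1999LowDim, §2 (2.1) (g = 1) and §3 Lemma (3.3)] -/
theorem isSquare_of_isIsogenous_of_cm (hE' : E'.dim = 1) (hd : 0 < d) (hd' : 0 < d')
    (hψ : ψ ≫ ψ = -(d • 𝟙 E)) (hψ' : ψ' ≫ ψ' = -(d' • 𝟙 E')) (h : E.IsIsogenous E') : IsSquare (d * d') := by
  haveI := nontrivial_endAlgebra_of_dim_eq_one hE'
  obtain ⟨u, hu⟩ := h
  obtain ⟨⟨Θ, -⟩, -⟩ := hu.exists_algHom_injective
  have hy : Θ (AbelianVariety.endAlgebra.of E (End.of ψ)) * Θ (AbelianVariety.endAlgebra.of E (End.of ψ)) =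
      -((d : ℚ) • (1 : E'.endAlgebra)) := by
    rw [← map_mul, endAlgebra_of_mul_self_of_cm hψ, map_neg, map_smul, map_one]
  exact CMQuadraticOrder.isSquare_mul_of_sq_eq_neg _
    (endAlgebra_of_mul_self_of_cm hψ') hd' (exists_pair_eq_of_cm hE' hd' hψ') hd hy

/-- **CM ELLIPTIC CURVES ARE ISOGENOUS IFF THEY HAVE CM BY THE SAME FIELD**: for `ψ ≫ ψ = -(d • 𝟙 E)`,
`ψ' ≫ ψ' = -(d' • 𝟙 E')` (`d, d' ≥ 1`), `E ~ E'` iff `d d'` is a square, i.e. iff `ℚ(√-d) = ℚ(√-d')`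
(`→`: `isSquare_of_isIsogenous_of_cm`; `←`: the tree's `hodgeIsogenous_of_cm_of_isSquare` with Riemann's theorem,
`moonenZarhin_lemma33_isIsogenous`). [cite: SilvermanAdvancedTopics1994, II §1 Prop. 1.2 and Prop. 1.4] [cite: SilvermanAEC2009, VI §4 Thm. 4.1 and §5 Thm. 5.5]
[cite: MoonenZarhin1999LowDim, §2 (2.1) (g = 1) and §3 Lemma (3.3)] -/
theorem isIsogenous_iff_isSquare_of_cm (hE : E.dim = 1) (hE' : E'.dim = 1) (hd : 0 < d) (hd' : 0 < d')
    (hψ : ψ ≫ ψ = -(d • 𝟙 E)) (hψ' : ψ' ≫ ψ' = -(d' • 𝟙 E')) : E.IsIsogenous E' ↔ IsSquare (d * d') :=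
  ⟨isSquare_of_isIsogenous_of_cm hE' hd hd' hψ hψ', fun hsq => EllipticCurve.moonenZarhin_lemma33_isIsogenous hE hE'
    (EllipticCurve.hodgeIsogenous_of_cm_of_isSquare hE hE' ψ ψ' hd hd' hψ hψ' hsq)⟩

/-- **Different CM fields ⟹ not isogenous** (the hypothesis `¬ IsSquare (d₁ d₂)` of the two-CM-curve anchors):
contrapositive of `isSquare_of_isIsogenous_of_cm`. [cite: SilvermanAdvancedTopics1994, II §1 Prop. 1.2 and Prop. 1.4] [cite: SilvermanAEC2009, VI §4 Thm. 4.1 and §5 Thm. 5.5] -/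
theorem not_isIsogenous_of_cm_of_not_isSquare (hE' : E'.dim = 1) (hd : 0 < d) (hd' : 0 < d')
    (hψ : ψ ≫ ψ = -(d • 𝟙 E)) (hψ' : ψ' ≫ ψ' = -(d' • 𝟙 E')) (hsq : ¬ IsSquare (d * d')) :
    ¬ E.IsIsogenous E' :=
  fun h => hsq (isSquare_of_isIsogenous_of_cm hE' hd hd' hψ hψ' h)

/-- **Same CM discriminant ⟹ isogenous**: two elliptic curves with complex multiplications of the same square
`-d` are isogenous. [cite: SilvermanAdvancedTopics1994, II §1 Prop. 1.2 and Prop. 1.4] [cite: SilvermanAEC2009, VI §4 Thm. 4.1 and §5 Thm. 5.5] -/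
theorem isIsogenous_of_cm_same (hE : E.dim = 1) (hE' : E'.dim = 1) (hd : 0 < d) (hψ : ψ ≫ ψ = -(d • 𝟙 E))
    (hψ' : ψ' ≫ ψ' = -(d • 𝟙 E')) : E.IsIsogenous E' :=
  (isIsogenous_iff_isSquare_of_cm hE hE' hd hd hψ hψ').2 ⟨d, rfl⟩

/-! ## §3 Isogeny classes of CM elliptic curves are isomorphism classes of `End⁰` -/

/-- **An isogeny of elliptic curves induces an isomorphism `End⁰(E) ≅ End⁰(E')` of `ℚ`-algebras** (the injective
transport `IsIsogeny.exists_algHom_injective` between algebras of the same finite dimension, `1` or `2` on both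
sides by `finrank_endAlgebra_eq_two_iff_isOfCMType` and isogeny invariance of CM type). [cite: MumfordAV1970, §19 Remark p. 169] -/
theorem nonempty_algEquiv_endAlgebra_of_isIsogenous (hE : E.dim = 1) (hE' : E'.dim = 1) (h : E.IsIsogenous E') :
    Nonempty (E.endAlgebra ≃ₐ[ℚ] E'.endAlgebra) := by
  haveI : Module.Finite ℚ E.endAlgebra := AbelianVariety.finiteDimensional_endAlgebra_holds E
  haveI : Module.Finite ℚ E'.endAlgebra := AbelianVariety.finiteDimensional_endAlgebra_holds E'
  obtain ⟨u, hu⟩ := h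
  obtain ⟨⟨Θ, hΘ⟩, -⟩ := hu.exists_algHom_injective
  have hdim : Module.finrank ℚ E.endAlgebra = Module.finrank ℚ E'.endAlgebra := by
    have hiff := isOfCMType_iff_of_isIsogenous (⟨u, hu⟩ : E.IsIsogenous E')
    rcases finrank_endAlgebra_eq_one_or_eq_two_of_dim_eq_one hE with h1 | h2
    · rw [h1, eq_comm, finrank_endAlgebra_eq_one_iff_not_isOfCMType hE']
      exact fun h' => ((finrank_endAlgebra_eq_one_iff_not_isOfCMType hE).1 h1) (hiff.2 h')
    · rw [h2, eq_comm, finrank_endAlgebra_eq_two_iff_isOfCMType hE']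
      exact hiff.1 ((finrank_endAlgebra_eq_two_iff_isOfCMType hE).1 h2)
  exact ⟨AlgEquiv.ofBijective Θ (CMQuadraticOrder.bijective_of_injective_of_finrank_eq Θ hΘ hdim)⟩

/-- **CM elliptic curves: `E ~ E'` iff `End⁰(E) ≅ End⁰(E')` as `ℚ`-algebras** (for `ψ ≫ ψ = -(d • 𝟙 E)`,
`ψ' ≫ ψ' = -(d' • 𝟙 E')`, `d, d' ≥ 1`): `→` by `nonempty_algEquiv_endAlgebra_of_isIsogenous`; `←`: the image of
`ψ` is a square root of `-d` in `End⁰(E') = ℚ·1 ⊕ ℚ·ψ'`, so `d d'` is a square.  Isogeny classes of CM elliptic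
curves correspond to imaginary quadratic fields. [cite: SilvermanAdvancedTopics1994, II §1 Prop. 1.2 and Prop. 1.4] [cite: SilvermanAEC2009, VI §4 Thm. 4.1 and §5 Thm. 5.5]
[cite: MoonenZarhin1999LowDim, §2 (2.1) (g = 1) and §3 Lemma (3.3)] -/
theorem isIsogenous_iff_nonempty_algEquiv_of_cm (hE : E.dim = 1) (hE' : E'.dim = 1) (hd : 0 < d) (hd' : 0 < d')
    (hψ : ψ ≫ ψ = -(d • 𝟙 E)) (hψ' : ψ' ≫ ψ' = -(d' • 𝟙 E')) :
    E.IsIsogenous E' ↔ Nonempty (E.endAlgebra ≃ₐ[ℚ] E'.endAlgebra) := by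
  refine ⟨nonempty_algEquiv_endAlgebra_of_isIsogenous hE hE', fun ⟨e⟩ => ?_⟩
  haveI := nontrivial_endAlgebra_of_dim_eq_one hE'
  have hy : e (AbelianVariety.endAlgebra.of E (End.of ψ)) * e (AbelianVariety.endAlgebra.of E (End.of ψ)) =
      -((d : ℚ) • (1 : E'.endAlgebra)) := by
    rw [← map_mul, endAlgebra_of_mul_self_of_cm hψ, map_neg, map_smul, map_one]
  exact (isIsogenous_iff_isSquare_of_cm hE hE' hd hd' hψ hψ').2
    (CMQuadraticOrder.isSquare_mul_of_sq_eq_neg _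
      (endAlgebra_of_mul_self_of_cm hψ') hd' (exists_pair_eq_of_cm hE' hd' hψ') hd hy)

/-- **Elliptic curves of CM type: `E ~ E'` iff `End⁰(E) ≅ End⁰(E')`** (Milne's `IsOfCMType`, via the complex
multiplications supplied by `isOfCMType_iff_exists_cm_of_dim_eq_one`). [cite: SilvermanAdvancedTopics1994, II §1 Prop. 1.2 and Prop. 1.4] [cite: SilvermanAEC2009, VI §4 Thm. 4.1 and §5 Thm. 5.5]
[cite: Milne1999, §2 p. 54] -/
theorem isIsogenous_iff_nonempty_algEquiv_of_isOfCMType (hE : E.dim = 1) (hE' : E'.dim = 1)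
    (hcm : Literature.AlgebraicGeometry.Milne1999.IsOfCMType E)
    (hcm' : Literature.AlgebraicGeometry.Milne1999.IsOfCMType E') :
    E.IsIsogenous E' ↔ Nonempty (E.endAlgebra ≃ₐ[ℚ] E'.endAlgebra) := by
  obtain ⟨ψ, d, hd, hψ⟩ := (isOfCMType_iff_exists_cm_of_dim_eq_one hE).1 hcm
  obtain ⟨ψ', d', hd', hψ'⟩ := (isOfCMType_iff_exists_cm_of_dim_eq_one hE').1 hcm'
  exact isIsogenous_iff_nonempty_algEquiv_of_cm hE hE' hd hd' hψ hψ'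

/-- **A CM elliptic curve is never isogenous to a non-CM one** (CM type is an isogeny invariant,
`isOfCMType_iff_of_isIsogenous`; recorded here next to the classification for completeness).
[cite: Milne1999, §2 p. 54] [cite: MumfordAV1970, §19 Remark p. 169] -/
theorem not_isIsogenous_of_isOfCMType_of_not (hcm : Literature.AlgebraicGeometry.Milne1999.IsOfCMType E)
    (hcm' : ¬ Literature.AlgebraicGeometry.Milne1999.IsOfCMType E') : ¬ E.IsIsogenous E' :=
  fun h => hcm' ((isOfCMType_iff_of_isIsogenous h).1 hcm)

end Summit.HodgeConjecture.CorCM.PeriodCurve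

end
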